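import Mathlib
import Literature.Barriers.CriticalPhenomena.SubexponentialGrowthZd
import Literature.Probability.Percolation.Percolation
import HarnessLib

/-!
# SuperlinearGrowthCriticalProb

Topic `Literature/Probability/Percolation`. Named literature fact(s) relocated by the gate from `Summits/CriticalPhenomena/PercolationContinuityZ3/Theorems/Transplant/ConjFourHypothesisGrowth.lean`
(accept-time relocation of `[cite]`d propositions written inline in a Summits proposal; human ruling 2026-08-15).
Sources: DuminilCopinGoswamiRaoufiSeveroYadin2020.

* `Literature.Probability.Percolation.DGRSY2020_superlinear_criticalProb_lt_one`
-/

namespace Literature.Probability.Percolation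

open SimpleGraph Filter Literature.Barriers.CriticalPhenomena Literature.Probability.LatticeModels Literature.Probability.Percolation
open scoped Classical

/-- **Duminil-Copin–Goswami–Raoufi–Severo–Yadin 2020, Theorem 1.3** (verbatim): "Let `G` be a quasi-transitive [graph] with super-linear growth, then
`p_c(G) < 1`", where (ibid.) "`B_r(x)` [is] the ball of radius `r` centered at `x` with respect to the graph distance. We say that a graph `G` has
super-linear growth if `limsup (1/r)|B_r(x)| = +∞`."  Stated here for connected locally finite quasi-transitive graphs (the paper's standing
assumptions), with super-linear growth at the vertex `x` in the equivalent form "for every `C` some ball has `|B(x, r)| > C(r+1)`", and the conclusion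
at that vertex (`p_c` does not depend on the vertex of a connected graph).  NOT proved in the tree (proof: isoperimetry `d > 4` via the Gaussian free
field, or Trofimov + `ℤ² ≤ Γ` for polynomial growth).
[cite: DuminilCopinGoswamiRaoufiSeveroYadin2020, Thm. 1.3 (p. 4)] [file Probability/Percolation/SuperlinearGrowthCriticalProb] -/
def DGRSY2020_superlinear_criticalProb_lt_one : Prop :=
  ∀ {V : Type} (G : SimpleGraph V) [G.LocallyFinite], G.Connected → Literature.Barriers.CriticalPhenomena.IsQuasiTransitive G →
    ∀ x : V, (∀ C : ℕ, ∃ r : ℕ, C * (r + 1) < Literature.Barriers.CriticalPhenomena.ballVolume G x r) →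
      Literature.Probability.Percolation.criticalProb G x < 1

end Literature.Probability.Percolation
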